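import Summits.QuantumFields.YangMills.Theorems.BalabanUVNodesN15BackgroundUnitByName
import Summits.QuantumFields.YangMills.Theorems.BalabanUVNodesN15VectorPieceVWordsCoarse
import HarnessLib

/-!
# Route «BalabanUVNodes» (K4 «SpineRates»), node N15 = NE2 — THE UNIT-LATTICE LAYER WITH THE BACKGROUND LIVE, III: `T4EtaRate.NE2PlusUnit` BY NAME FOR THE U = 1
# VECTOR PIECE ⊗ 1_𝔤 — the dressed unit covariance `[a − a²Q(U′U)(G⊗1)(U′U)Q*(U′U)]⁻¹` over the SAME paired instances `v1GVecInstance` as F16's operator layer and S6's site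
# layer, every `U ≡ 1` OPERATOR input a landed theorem, the `U ≡ 1` UNIT COVARIANCES displayed (rate number `θ₀ = L^{−1∕4}`, so `L ≥ 2`)

Cell `pub-ymgap`, seat `pub-ymgap-dag-n15-c` (generation g5; R134 ACCELERATION SEAT, strategy s1; HUMAN RULING D-0062; chair R424 venue; `bears_on: R4∕N15`).  Filed
`--supports stmt-QuantumFields-20292 --as helper` (K3⁗; count-neutral).  Imports this seat's U3 `…N15BackgroundUnitByName` (`ne2PlusUnit_vWGC`, `vWGCUnitKernel`) and g4's F16
`…N15VectorPieceVWordsCoarse` (the vector-piece data) BY NAME; nothing in the tree is modified.  The unit twin of S6 `…N15VectorPieceSite` (same data, proof skeleton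
VERBATIM; the differences: the quantifier block of `NE2PlusUnit` — no `M₅`, clean rate `θ₀^k` with `θ₀ = L^{−1∕4} < 1`, hence `2 ≤ L` — and the unit form `a − a²(…)` in place
of the site form).

WHAT THIS FILE IS.  `vWGCVecUnitKernel` (U3's family fed with F16's data + averaging species + `U ≡ 1` unit covariances), ★★ **`ne2PlusUnit_vectorPiece_vWordsGC`**: `NE2PlusUnit
c₃₅ (v1GVecInstance …) (vWGCVecUnitKernel …) ⊤ d` for `d + 1 ≥ 2`, `L ≥ 2`, `c₃₅ > 0`, ANY averaging species with the six (3.35)-letters and ANY `U ≡ 1` unit covariances with a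
uniform decaying majorant inverting `a − a²Q(G⊗1)Q*` ∕ `a − a²Q′(G′⊗1)Q′*`; `_dim4`; ★ `…vWordsExpC` (g4 F9's parallel-transport species), `…vWordsLinC` (F7).

HONEST FRAMING ∕ LIMITS.  LINEAR (`U ≡ 1`) vector single-scale piece ⊗ 1_𝔤 dressed by the (3.60)-shaped `V′(A′)`; the unit form `a − a²Q(G⊗1)Q*` of the PIECE is the FORMAL
analogue of King's `Δ^{(k)} = a − a²QG_kQ*` (which holds for the FULL `G_k`); the `U ≡ 1` UNIT COVARIANCES (its inverse, with decay) are DISPLAYED hypotheses, as are the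
averaging species' letters; transport = fibrewise mean; one-level contour; `inΛ = ⊤`, `unitDist` = King's torus sup-distance; NE2⁺ NOT PRINTED, NOT proved for Bałaban's
`C^{(k)}(Λ;U)`; count-neutral (typed 28∕28; discharged count unchanged); N15 NOT discharged; one finite T⁴ at fixed ε — NOT ℝ⁴, NOT infinite volume, NOT OS, NOT a mass gap,
NOT Clay.
-/

noncomputable section

open scoped BigOperators
open Finset

namespace Summit.QuantumFields.YangMills.BalabanUVNodes.N15.VectorPiece

open Literature.MathematicalPhysics.QuantumFieldTheory.Balaban1983to89
open Literature.MathematicalPhysics.QuantumFieldTheory.Balaban1983to89.B11SectG (BlockNorm HasMaj RowSum)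
open Literature.MathematicalPhysics.QuantumFieldTheory.Balaban1983to89.B6RandomWalk (Triangle254)
open Literature.MathematicalPhysics.QuantumFieldTheory.Balaban1983to89.T4EtaRate (PairedInstance NE2PlusUnit)
open Literature.MathematicalPhysics.QuantumFieldTheory.Balaban1983to89.T4EtaRateDefect (idef rateWeight)
open Literature.MathematicalPhysics.QuantumFieldTheory.Balaban1983to89.T4EtaRateCoeffDefect (pull diagK fibre)
open Literature.MathematicalPhysics.QuantumFieldTheory.Balaban1983to89.B5Prop11Plancherel (Tor fine unitVec)
open Literature.MathematicalPhysics.QuantumFieldTheory.Balaban1983to89.B6UnitTorusCarrier (unitTorusGeo unitTorusGeo_len triangle254_unitTorusGeo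
  rowSum_unitTorusGeo)
open Literature.MathematicalPhysics.QuantumFieldTheory.King1986.Torus (tdistT tdistT_nonneg)
open Summit.QuantumFields.YangMills.BalabanUVNodes.N15.MatrixSpecies (liftMap liftBlk basisConst_nonneg)
open Summit.QuantumFields.YangMills.BalabanUVNodes.N15.SiteLayer (unitForm₀ vWGCUnitKernel ne2PlusUnit_vWGC hasMaj_exp_mono)

variable {d : ℕ}

section Knit

variable (𝔄 : Type) [NormedRing 𝔄] [NormedAlgebra ℝ 𝔄] [CompleteSpace 𝔄] (ι : Type) [Fintype ι] [DecidableEq ι] (e : 𝔄 ≃L[ℝ] (ι → ℝ)) (L : ℕ) [NeZero L]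
  (a : ℝ)

/-- THE REALISED UNIT-COVARIANCE FAMILY AT THE VECTOR PIECE ⊗ 1_𝔤: U3's `vWGCUnitKernel` fed with F16's data (the -a pieces `G`, `dPieces` at both spacings, King's pairing,
word species `vecWordC`∕`vecWordF`), the averaging species `Fc, Fsc, Ff, Fsf`, the unit-bond site lattice blocked by the bond's base point, and the `U ≡ 1` unit
covariances `Ws j` (coarse), `Ws′ j` (fine); the (3.24) weight `a` is King's constant. [cite: King1986, (4.33) p.673 (shape); Balaban1985BackgroundPropagators, Thm 3.15 (3.187) p.432 (shape)] -/
def vWGCVecUnitKernel (hL : 1 ≤ L)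
    (Fc : ∀ j : VecIndexS d L, (Fin (d + 1) → Tor (fine (L ^ j.m * L ^ j.k) j.Mn) × Fin (d + 1) → 𝔄) →
      (((Tor (fine (L ^ j.k) j.Mn) × Fin (d + 1)) × ι → ℝ) →ₗ[ℝ] ((Tor j.Mn × Fin (d + 1)) × ι → ℝ)))
    (Fsc : ∀ j : VecIndexS d L, (Fin (d + 1) → Tor (fine (L ^ j.m * L ^ j.k) j.Mn) × Fin (d + 1) → 𝔄) →
      (((Tor j.Mn × Fin (d + 1)) × ι → ℝ) →ₗ[ℝ] ((Tor (fine (L ^ j.k) j.Mn) × Fin (d + 1)) × ι → ℝ)))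
    (Ff : ∀ j : VecIndexS d L, (Fin (d + 1) → Tor (fine (L ^ j.m * L ^ j.k) j.Mn) × Fin (d + 1) → 𝔄) →
      (((Tor (fine (L ^ j.m * L ^ j.k) j.Mn) × Fin (d + 1)) × ι → ℝ) →ₗ[ℝ] ((Tor j.Mn × Fin (d + 1)) × ι → ℝ)))
    (Fsf : ∀ j : VecIndexS d L, (Fin (d + 1) → Tor (fine (L ^ j.m * L ^ j.k) j.Mn) × Fin (d + 1) → 𝔄) →
      (((Tor j.Mn × Fin (d + 1)) × ι → ℝ) →ₗ[ℝ] ((Tor (fine (L ^ j.m * L ^ j.k) j.Mn) × Fin (d + 1)) × ι → ℝ)))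
    (Ws Ws' : ∀ j : VecIndexS d L, ((Tor j.Mn × Fin (d + 1)) × ι → ℝ) →ₗ[ℝ] ((Tor j.Mn × Fin (d + 1)) × ι → ℝ)) (j : VecIndexS d L) :
    B9.SiteKernel (v1GVecInstance (d := d) 𝔄 ι L hL j).gc (v1GVecInstance (d := d) 𝔄 ι L hL j).Bf :=
  vWGCUnitKernel e (fun j : VecIndexS d L => unitTorusGeoS L j.k j.Mn j.Msz) (fun j => Tor (fine (L ^ j.k) j.Mn) × Fin (d + 1))
    (fun j => Tor (fine (L ^ j.m * L ^ j.k) j.Mn) × Fin (d + 1)) (fun j => (Tor j.Mn × Fin (d + 1)) × ι) (fun j => blkFine L j.k j.Mn)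
    (fun j => liftBlk (fun b : Tor j.Mn × Fin (d + 1) => b.1) ι) (fun j => liftMap (qbond L j.k j.Mn) ι) (fun j => kingPrV L j.k j.m j.Mn) (fun j => j.m)
    (fun j => unitTorusGeoS_L_ne_zero L hL j)
    (fun j => tensorId ι (pieceG L j.Mn (L ^ j.k) j.k (rweight (d := d) L j.k)))
    (fun j μ => tensorId ι (dPieces L j.Mn (L ^ j.k) j.k (rweight (d := d) L j.k) μ))
    (fun j => tensorId ι (pieceG L j.Mn (L ^ j.m * L ^ j.k) (j.k + j.m) (rweight (d := d) L j.k / ((L : ℝ) ^ j.m) ^ (d + 1))))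
    (fun j μ => tensorId ι (dPieces L j.Mn (L ^ j.m * L ^ j.k) (j.k + j.m) (rweight (d := d) L j.k / ((L : ℝ) ^ j.m) ^ (d + 1)) μ))
    (fun j κ => bshiftEquiv j.Mn (L ^ j.k) κ) (fun j κ => bshiftEquiv j.Mn (L ^ j.m * L ^ j.k) κ)
    (fun j => vecWordC ι L a j (Fc j) (Fsc j)) (fun j => vecWordF ι L a j (Ff j) (Fsf j)) Fc Fsc Ff Fsf Ws Ws' a j

variable {𝔄 ι L}

/-- **NE2⁺, UNIT-LATTICE LAYER — `T4EtaRate.NE2PlusUnit c₃₅` BY NAME FOR THE U = 1 VECTOR PIECE ⊗ 1_𝔤 DRESSED BY THE (3.60)-SHAPED FULL PERTURBATION, GAUGE FIELD THE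
DATUM** — on F16's paired instances `v1GVecInstance` (`L ≥ 2` for the clean rate `θ₀ = L^{−1∕4} < 1`), for ANY averaging species with the six letters and ANY `U ≡ 1` unit
covariances `Ws j, Ws′ j` on the unit-bond site lattice with a uniform majorant `β_W·e^{−δ_W d}` inverting `a − a²Q(G⊗1)Q*` ∕ `a − a²Q′(G′⊗1)Q′*`; every `U ≡ 1` operator input
a landed theorem (`uniform_layer_v1M`, `card_fibre_kingPrV_lift`, `kingPrV_bshiftEquiv_pow`, `fibre_conn_kingPrV`).  Inside: `ne2PlusUnit_vWGC` at the rate `min(δ, δ_W)`,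
`σ = min(δ, δ_W)∕10`, `c_W = |a|c_F(2 + c_F)`, `θ_j = (L^{k})^{−1∕4} = θ₀^k`. [cite: Balaban1985BackgroundPropagators, Thm 3.15 (3.187) p.432 (quantifier template), (3.35)–(3.36) p.396, (3.60) p.402, (3.65)–(3.67) p.403 (shapes, mechanism); King1986, (4.33) p.673, Lemma 4.5 (4.38) p.674, (4.42)–(4.43) p.675, p.664] -/
theorem ne2PlusUnit_vectorPiece_vWordsGC (hd : 1 ≤ d) (hL : 1 ≤ L) (hL2 : 2 ≤ L) (c35 : ℝ) (hc35 : 0 < c35) {cF : ℝ} (hcF : 0 ≤ cF)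
    (Fc : ∀ j : VecIndexS d L, (Fin (d + 1) → Tor (fine (L ^ j.m * L ^ j.k) j.Mn) × Fin (d + 1) → 𝔄) →
      (((Tor (fine (L ^ j.k) j.Mn) × Fin (d + 1)) × ι → ℝ) →ₗ[ℝ] ((Tor j.Mn × Fin (d + 1)) × ι → ℝ)))
    (Fsc : ∀ j : VecIndexS d L, (Fin (d + 1) → Tor (fine (L ^ j.m * L ^ j.k) j.Mn) × Fin (d + 1) → 𝔄) →
      (((Tor j.Mn × Fin (d + 1)) × ι → ℝ) →ₗ[ℝ] ((Tor (fine (L ^ j.k) j.Mn) × Fin (d + 1)) × ι → ℝ)))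
    (Ff : ∀ j : VecIndexS d L, (Fin (d + 1) → Tor (fine (L ^ j.m * L ^ j.k) j.Mn) × Fin (d + 1) → 𝔄) →
      (((Tor (fine (L ^ j.m * L ^ j.k) j.Mn) × Fin (d + 1)) × ι → ℝ) →ₗ[ℝ] ((Tor j.Mn × Fin (d + 1)) × ι → ℝ)))
    (Fsf : ∀ j : VecIndexS d L, (Fin (d + 1) → Tor (fine (L ^ j.m * L ^ j.k) j.Mn) × Fin (d + 1) → 𝔄) →
      (((Tor j.Mn × Fin (d + 1)) × ι → ℝ) →ₗ[ℝ] ((Tor (fine (L ^ j.m * L ^ j.k) j.Mn) × Fin (d + 1)) × ι → ℝ)))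
    (hF : ∀ (j : VecIndexS d L) (α₀ : ℝ) A', 0 < α₀ → 2 * (c35 * (j.Msz * α₀)) ≤ 1 → (v1GVecInstance (d := d) 𝔄 ι L hL j).Bf.Reg335 c35 α₀ A' →
      HasMaj (BlockNorm.ofBlocks (unitTorusGeoS L j.k j.Mn j.Msz) (liftBlk (blkFine L j.k j.Mn) ι))
        (BlockNorm.ofBlocks (unitTorusGeoS L j.k j.Mn j.Msz) (liftBlk (fun b : Tor j.Mn × Fin (d + 1) => b.1) ι)) (Fc j A')
        (diagK fun _ => cF * (c35 * j.Msz * α₀)) ∧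
      HasMaj (BlockNorm.ofBlocks (unitTorusGeoS L j.k j.Mn j.Msz) (liftBlk (fun b : Tor j.Mn × Fin (d + 1) => b.1) ι))
        (BlockNorm.ofBlocks (unitTorusGeoS L j.k j.Mn j.Msz) (liftBlk (blkFine L j.k j.Mn) ι)) (Fsc j A') (diagK fun _ => cF * (c35 * j.Msz * α₀)) ∧
      HasMaj (BlockNorm.ofBlocks (unitTorusGeoS L j.k j.Mn j.Msz) (liftBlk (blkFine L j.k j.Mn ∘ kingPrV L j.k j.m j.Mn) ι))
        (BlockNorm.ofBlocks (unitTorusGeoS L j.k j.Mn j.Msz) (liftBlk (fun b : Tor j.Mn × Fin (d + 1) => b.1) ι)) (Ff j A')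
        (diagK fun _ => cF * (c35 * j.Msz * α₀)) ∧
      HasMaj (BlockNorm.ofBlocks (unitTorusGeoS L j.k j.Mn j.Msz) (liftBlk (fun b : Tor j.Mn × Fin (d + 1) => b.1) ι))
        (BlockNorm.ofBlocks (unitTorusGeoS L j.k j.Mn j.Msz) (liftBlk (blkFine L j.k j.Mn ∘ kingPrV L j.k j.m j.Mn) ι)) (Fsf j A')
        (diagK fun _ => cF * (c35 * j.Msz * α₀)) ∧
      HasMaj (BlockNorm.ofBlocks (unitTorusGeoS L j.k j.Mn j.Msz) (liftBlk (blkFine L j.k j.Mn) ι))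
        (BlockNorm.ofBlocks (unitTorusGeoS L j.k j.Mn j.Msz) (liftBlk (fun b : Tor j.Mn × Fin (d + 1) => b.1) ι))
        (idef (pull (liftMap (kingPrV L j.k j.m j.Mn) ι)) LinearMap.id (Ff j A') (Fc j A')) (diagK fun _ => cF * (c35 * j.Msz * α₀) * thetaV L j) ∧
      HasMaj (BlockNorm.ofBlocks (unitTorusGeoS L j.k j.Mn j.Msz) (liftBlk (fun b : Tor j.Mn × Fin (d + 1) => b.1) ι))
        (BlockNorm.ofBlocks (unitTorusGeoS L j.k j.Mn j.Msz) (liftBlk (blkFine L j.k j.Mn ∘ kingPrV L j.k j.m j.Mn) ι))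
        (idef LinearMap.id (pull (liftMap (kingPrV L j.k j.m j.Mn) ι)) (Fsf j A') (Fsc j A')) (diagK fun _ => cF * (c35 * j.Msz * α₀) * thetaV L j))
    (Ws Ws' : ∀ j : VecIndexS d L, ((Tor j.Mn × Fin (d + 1)) × ι → ℝ) →ₗ[ℝ] ((Tor j.Mn × Fin (d + 1)) × ι → ℝ)) {βW δW : ℝ} (hβW : 0 ≤ βW) (hδW : 0 < δW)
    (hWs : ∀ j, HasMaj (BlockNorm.ofBlocks (unitTorusGeoS L j.k j.Mn j.Msz) (liftBlk (fun b : Tor j.Mn × Fin (d + 1) => b.1) ι))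
      (BlockNorm.ofBlocks (unitTorusGeoS L j.k j.Mn j.Msz) (liftBlk (fun b : Tor j.Mn × Fin (d + 1) => b.1) ι)) (Ws j)
      (fun y y' => βW * Real.exp (-(δW * (unitTorusGeoS L j.k j.Mn j.Msz).dist y y'))))
    (hWs' : ∀ j, HasMaj (BlockNorm.ofBlocks (unitTorusGeoS L j.k j.Mn j.Msz) (liftBlk (fun b : Tor j.Mn × Fin (d + 1) => b.1) ι))
      (BlockNorm.ofBlocks (unitTorusGeoS L j.k j.Mn j.Msz) (liftBlk (fun b : Tor j.Mn × Fin (d + 1) => b.1) ι)) (Ws' j)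
      (fun y y' => βW * Real.exp (-(δW * (unitTorusGeoS L j.k j.Mn j.Msz).dist y y'))))
    (hKW : ∀ j, unitForm₀ a (liftMap (qbond L j.k j.Mn) ι) (tensorId ι (pieceG L j.Mn (L ^ j.k) j.k (rweight (d := d) L j.k))) ∘ₗ Ws j = LinearMap.id)
    (hKW' : ∀ j, unitForm₀ a (liftMap (qbond L j.k j.Mn) ι ∘ liftMap (kingPrV L j.k j.m j.Mn) ι)
      (tensorId ι (pieceG L j.Mn (L ^ j.m * L ^ j.k) (j.k + j.m) (rweight (d := d) L j.k / ((L : ℝ) ^ j.m) ^ (d + 1)))) ∘ₗ Ws' j = LinearMap.id) :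
    NE2PlusUnit c35 (v1GVecInstance (d := d) 𝔄 ι L hL) (vWGCVecUnitKernel (d := d) 𝔄 ι e L a hL Fc Fsc Ff Fsf Ws Ws') (fun _ _ => True)
      (fun j => (unitTorusGeoS L j.k j.Mn j.Msz).dist) := by
  obtain ⟨β, δ₁, m₀, hβ, hδ₁, hm₀, H⟩ := uniform_layer_v1M (d := d) (ι := ι) (L := L) hd hL
  have hL0 : L ≠ 0 := by omega
  have hLr : (0 : ℝ) < (L : ℝ) := by exact_mod_cast (show 0 < L by omega)
  have hL1 : (1 : ℝ) ≤ (L : ℝ) := by exact_mod_cast hL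
  -- the common rate of the `U ≡ 1` operator layer and the `U ≡ 1` site kernels
  set δ : ℝ := min δ₁ δW with hδdef
  have hδ : 0 < δ := lt_min hδ₁ hδW
  have hδδ₁ : δ ≤ δ₁ := min_le_left _ _
  have hδδW : δ ≤ δW := min_le_right _ _
  have hσ : 0 < δ / 10 := by positivity
  -- the clean rate number θ₀ = L^{−1/4} < 1 and θ_j = θ₀^k
  have hθ₀ : 0 < ((L : ℝ) ^ (-(1 / 4 : ℝ))) := Real.rpow_pos_of_pos hLr _
  have hθ₁ : ((L : ℝ) ^ (-(1 / 4 : ℝ))) < 1 := by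
    have hL2r : (1 : ℝ) < (L : ℝ) := by exact_mod_cast hL2
    exact Real.rpow_lt_one_of_one_lt_of_neg hL2r (by norm_num)
  have hθk : ∀ j : VecIndexS d L, thetaV L j ≤ ((L : ℝ) ^ (-(1 / 4 : ℝ))) ^ j.k := fun j => by
    have hpow : ((L : ℝ) ^ (-(1 / 4 : ℝ))) ^ j.k = ((L : ℝ) ^ j.k) ^ (-(1 / 4 : ℝ)) := by
      rw [← Real.rpow_natCast ((L : ℝ) ^ (-(1 / 4 : ℝ))) j.k, ← Real.rpow_mul hLr.le, mul_comm, Real.rpow_mul hLr.le, Real.rpow_natCast]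
    unfold thetaV
    exact le_of_eq hpow.symm
  have hd1 : (0 : ℝ) ≤ 2 * ((d : ℝ) + 1) := by positivity
  have hcW : 0 ≤ |a| * cF * (2 + cF) := by positivity
  have hdist : ∀ (j : VecIndexS d L) (y y' : (unitTorusGeoS L j.k j.Mn j.Msz).Site), 0 ≤ (unitTorusGeoS L j.k j.Mn j.Msz).dist y y' :=
    fun j y y' => tdistT_nonneg _ _ _
  have hθ0 : ∀ j : VecIndexS d L, 0 ≤ thetaV L j := fun j => by unfold thetaV; positivity
  -- `C_π(j)·η′_j ≤ 2(d+1)·θ_j` (F16)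
  have hCθ : ∀ j : VecIndexS d L, ((2 * ((d + 1) * (L ^ j.m - 1)) : ℕ) : ℝ) *
      ((unitTorusGeoS L j.k j.Mn j.Msz).eta * ((unitTorusGeoS L j.k j.Mn j.Msz).L ^ j.m)⁻¹) ≤ 2 * ((d : ℝ) + 1) * thetaV L j := by
    intro j
    have hLm : (0 : ℝ) < (L : ℝ) ^ j.m := pow_pos hLr _
    have hLk : (0 : ℝ) < (L : ℝ) ^ j.k := pow_pos hLr _
    have hθ : ((L : ℝ) ^ j.k)⁻¹ ≤ thetaV L j := inv_pow_le_rpow hL j.k (by norm_num)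
    have hsub : (((L ^ j.m - 1 : ℕ)) : ℝ) ≤ (L : ℝ) ^ j.m := by
      have h1 : 1 ≤ L ^ j.m := Nat.one_le_pow _ _ (by omega)
      rw [Nat.cast_sub h1]; push_cast; linarith
    show ((2 * ((d + 1) * (L ^ j.m - 1)) : ℕ) : ℝ) * (((L : ℝ) ^ j.k)⁻¹ * ((L : ℝ) ^ j.m)⁻¹) ≤ 2 * ((d : ℝ) + 1) * thetaV L j
    have hcast : ((2 * ((d + 1) * (L ^ j.m - 1)) : ℕ) : ℝ) = 2 * ((d : ℝ) + 1) * (((L ^ j.m - 1 : ℕ)) : ℝ) := by push_cast; ring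
    rw [hcast]
    calc 2 * ((d : ℝ) + 1) * (((L ^ j.m - 1 : ℕ)) : ℝ) * (((L : ℝ) ^ j.k)⁻¹ * ((L : ℝ) ^ j.m)⁻¹)
        ≤ 2 * ((d : ℝ) + 1) * (L : ℝ) ^ j.m * (((L : ℝ) ^ j.k)⁻¹ * ((L : ℝ) ^ j.m)⁻¹) :=
          mul_le_mul_of_nonneg_right (mul_le_mul_of_nonneg_left hsub hd1) (by positivity)
      _ = 2 * ((d : ℝ) + 1) * ((L : ℝ) ^ j.k)⁻¹ := by field_simp
      _ ≤ 2 * ((d : ℝ) + 1) * thetaV L j := mul_le_mul_of_nonneg_left hθ hd1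
  -- the word letters from the species letters (F4 `vecWord_letters`)
  have hW := fun (j : VecIndexS d L) (α₀ : ℝ) (A' : Fin (d + 1) → Tor (fine (L ^ j.m * L ^ j.k) j.Mn) × Fin (d + 1) → 𝔄) (hα₀ : 0 < α₀)
      (hsm : 2 * (c35 * (j.Msz * α₀)) ≤ 1) (hreg : (v1GVecInstance (d := d) 𝔄 ι L hL j).Bf.Reg335 c35 α₀ A') =>
    vecWord_letters ι L a j hc35 hα₀ hcF hsm (hF j α₀ A' hα₀ hsm hreg).1 (hF j α₀ A' hα₀ hsm hreg).2.1 (hF j α₀ A' hα₀ hsm hreg).2.2.1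
      (hF j α₀ A' hα₀ hsm hreg).2.2.2.1 (hF j α₀ A' hα₀ hsm hreg).2.2.2.2.1 (hF j α₀ A' hα₀ hsm hreg).2.2.2.2.2
  -- the block-translation law of King's pairing and `η = L^m·η′` (F16)
  have hblk : ∀ (j : VecIndexS d L) (μ : Fin (d + 1)) (x' : Tor (fine (L ^ j.m * L ^ j.k) j.Mn) × Fin (d + 1)),
      kingPrV L j.k j.m j.Mn ((bshiftEquiv j.Mn (L ^ j.m * L ^ j.k) μ ^ (L ^ j.m)) x') =
        bshiftEquiv j.Mn (L ^ j.k) μ (kingPrV L j.k j.m j.Mn x') := fun j μ x' => kingPrV_bshiftEquiv_pow L j.k j.m j.Mn μ x'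
  have hN : ∀ j : VecIndexS d L, (unitTorusGeoS L j.k j.Mn j.Msz).eta =
      ((L ^ j.m : ℕ) : ℝ) * ((unitTorusGeoS L j.k j.Mn j.Msz).eta * ((unitTorusGeoS L j.k j.Mn j.Msz).L ^ j.m)⁻¹) := by
    intro j
    show ((L : ℝ) ^ j.k)⁻¹ = ((L ^ j.m : ℕ) : ℝ) * (((L : ℝ) ^ j.k)⁻¹ * ((L : ℝ) ^ j.m)⁻¹)
    have hLm : (0 : ℝ) < (L : ℝ) ^ j.m := pow_pos hLr _
    push_cast
    field_simp
  -- the `U ≡ 1` letters at the common rate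
  have hme : ∀ j : VecIndexS d L, 0 ≤ m₀ * thetaV L j := fun j => mul_nonneg hm₀.le (hθ0 j)
  exact ne2PlusUnit_vWGC e (I := VecIndexS d L) (J := Fin (d + 1)) (fun j => unitTorusGeoS L j.k j.Mn j.Msz)
    (fun j => Tor (fine (L ^ j.k) j.Mn) × Fin (d + 1)) (fun j => Tor (fine (L ^ j.m * L ^ j.k) j.Mn) × Fin (d + 1)) (fun j => (Tor j.Mn × Fin (d + 1)) × ι)
    (fun j => blkFine L j.k j.Mn) (fun j => liftBlk (fun b : Tor j.Mn × Fin (d + 1) => b.1) ι) (fun j => liftMap (qbond L j.k j.Mn) ι)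
    (fun j => kingPrV L j.k j.m j.Mn) (fun j => j.m) (fun j => unitTorusGeoS_L_ne_zero L hL j) (thetaV L)
    (fun j => tensorId ι (pieceG L j.Mn (L ^ j.k) j.k (rweight (d := d) L j.k)))
    (fun j μ => tensorId ι (dPieces L j.Mn (L ^ j.k) j.k (rweight (d := d) L j.k) μ))
    (fun j => tensorId ι (pieceG L j.Mn (L ^ j.m * L ^ j.k) (j.k + j.m) (rweight (d := d) L j.k / ((L : ℝ) ^ j.m) ^ (d + 1))))
    (fun j μ => tensorId ι (dPieces L j.Mn (L ^ j.m * L ^ j.k) (j.k + j.m) (rweight (d := d) L j.k / ((L : ℝ) ^ j.m) ^ (d + 1)) μ))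
    (fun j κ => bshiftEquiv j.Mn (L ^ j.k) κ) (fun j κ => bshiftEquiv j.Mn (L ^ j.m * L ^ j.k) κ) (fun j => ((2 * ((d + 1) * (L ^ j.m - 1)) : ℕ) : ℝ))
    (fun j => L ^ j.m) (fun j => (L ^ j.m) ^ (d + 1))
    (fun j => vecWordC ι L a j (Fc j) (Fsc j)) (fun j => vecWordF ι L a j (Ff j) (Fsf j)) Fc Fsc Ff Fsf Ws Ws' a c35 hc35 hθ₀ hθ₁ hθk (fun j => j.one_le_Msz)
    (fun j => triangle254_unitTorusGeo L j.k j.Mn) hdist hσ.le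
    (B4Sect5Proof.latticeConst_nonneg (d + 1) hσ.le) (fun j => rowSum_unitTorusGeo L j.k j.Mn hσ)
    (fun j => inv_pos.mpr (pow_pos hLr _)) (fun j => inv_le_one_of_one_le₀ (one_le_pow₀ hL1)) (fun j => inv_pow_le_rpow hL j.k (by norm_num))
    (fun j => hL1)
    (by linarith) hβ.le hm₀.le
    (fun j μ κ x => bshiftEquiv_comm j.Mn (L ^ j.m * L ^ j.k) μ κ x) (fun j => Nat.cast_nonneg _)
    (fun j f b hf => fibre_conn_kingPrV L j.k j.m j.Mn f b hf) hd1 hCθ hcW hcF hβW hblk hN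
    (fun j pt => rfl) (fun j => pow_ne_zero _ (pow_ne_zero _ (NeZero.ne L))) (fun j => card_fibre_kingPrV_lift L j.k j.m j.Mn ι)
    (fun j α₀ A' hα₀ hsm hreg => (hW j α₀ A' hα₀ hsm hreg).1) (fun j α₀ A' hα₀ hsm hreg => (hW j α₀ A' hα₀ hsm hreg).2.1)
    (fun j α₀ A' hα₀ hsm hreg => (hW j α₀ A' hα₀ hsm hreg).2.2)
    (fun j α₀ A' hα₀ hsm hreg => (hF j α₀ A' hα₀ hsm hreg).1) (fun j α₀ A' hα₀ hsm hreg => (hF j α₀ A' hα₀ hsm hreg).2.1)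
    (fun j α₀ A' hα₀ hsm hreg => (hF j α₀ A' hα₀ hsm hreg).2.2.1) (fun j α₀ A' hα₀ hsm hreg => (hF j α₀ A' hα₀ hsm hreg).2.2.2.1)
    (fun j α₀ A' hα₀ hsm hreg => (hF j α₀ A' hα₀ hsm hreg).2.2.2.2.1) (fun j α₀ A' hα₀ hsm hreg => (hF j α₀ A' hα₀ hsm hreg).2.2.2.2.2)
    (fun j => hasMaj_exp_mono (hdist j) hβ.le hδδ₁ (H j).1) (fun j μ => hasMaj_exp_mono (hdist j) hβ.le hδδ₁ ((H j).2.1 μ))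
    (fun j => hasMaj_exp_mono (hdist j) hβ.le hδδ₁ (H j).2.2.1) (fun j μ => hasMaj_exp_mono (hdist j) hβ.le hδδ₁ ((H j).2.2.2.1 μ))
    (fun j => hasMaj_exp_mono (hdist j) (hme j) hδδ₁ (H j).2.2.2.2.2.2.2.1)
    (fun j μ => hasMaj_exp_mono (hdist j) (hme j) hδδ₁ ((H j).2.2.2.2.2.2.2.2.1 μ))
    (fun j => hasMaj_exp_mono (hdist j) hβW hδδW (hWs j)) (fun j => hasMaj_exp_mono (hdist j) hβW hδδW (hWs' j)) hKW hKW'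

/-- The four-torus specialisation (`d + 1 = 4`, `L ≥ 2`). [folklore] -/
theorem ne2PlusUnit_vectorPiece_vWordsGC_dim4 (hL : 1 ≤ L) (hL2 : 2 ≤ L) (c35 : ℝ) (hc35 : 0 < c35) {cF : ℝ} (hcF : 0 ≤ cF)
    (Fc : ∀ j : VecIndexS 3 L, (Fin 4 → Tor (fine (L ^ j.m * L ^ j.k) j.Mn) × Fin 4 → 𝔄) →
      (((Tor (fine (L ^ j.k) j.Mn) × Fin 4) × ι → ℝ) →ₗ[ℝ] ((Tor j.Mn × Fin 4) × ι → ℝ)))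
    (Fsc : ∀ j : VecIndexS 3 L, (Fin 4 → Tor (fine (L ^ j.m * L ^ j.k) j.Mn) × Fin 4 → 𝔄) →
      (((Tor j.Mn × Fin 4) × ι → ℝ) →ₗ[ℝ] ((Tor (fine (L ^ j.k) j.Mn) × Fin 4) × ι → ℝ)))
    (Ff : ∀ j : VecIndexS 3 L, (Fin 4 → Tor (fine (L ^ j.m * L ^ j.k) j.Mn) × Fin 4 → 𝔄) →
      (((Tor (fine (L ^ j.m * L ^ j.k) j.Mn) × Fin 4) × ι → ℝ) →ₗ[ℝ] ((Tor j.Mn × Fin 4) × ι → ℝ)))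
    (Fsf : ∀ j : VecIndexS 3 L, (Fin 4 → Tor (fine (L ^ j.m * L ^ j.k) j.Mn) × Fin 4 → 𝔄) →
      (((Tor j.Mn × Fin 4) × ι → ℝ) →ₗ[ℝ] ((Tor (fine (L ^ j.m * L ^ j.k) j.Mn) × Fin 4) × ι → ℝ)))
    (hF : ∀ (j : VecIndexS 3 L) (α₀ : ℝ) A', 0 < α₀ → 2 * (c35 * (j.Msz * α₀)) ≤ 1 → (v1GVecInstance (d := 3) 𝔄 ι L hL j).Bf.Reg335 c35 α₀ A' →
      HasMaj (BlockNorm.ofBlocks (unitTorusGeoS L j.k j.Mn j.Msz) (liftBlk (blkFine L j.k j.Mn) ι))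
        (BlockNorm.ofBlocks (unitTorusGeoS L j.k j.Mn j.Msz) (liftBlk (fun b : Tor j.Mn × Fin 4 => b.1) ι)) (Fc j A') (diagK fun _ => cF * (c35 * j.Msz * α₀)) ∧
      HasMaj (BlockNorm.ofBlocks (unitTorusGeoS L j.k j.Mn j.Msz) (liftBlk (fun b : Tor j.Mn × Fin 4 => b.1) ι))
        (BlockNorm.ofBlocks (unitTorusGeoS L j.k j.Mn j.Msz) (liftBlk (blkFine L j.k j.Mn) ι)) (Fsc j A') (diagK fun _ => cF * (c35 * j.Msz * α₀)) ∧
      HasMaj (BlockNorm.ofBlocks (unitTorusGeoS L j.k j.Mn j.Msz) (liftBlk (blkFine L j.k j.Mn ∘ kingPrV L j.k j.m j.Mn) ι))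
        (BlockNorm.ofBlocks (unitTorusGeoS L j.k j.Mn j.Msz) (liftBlk (fun b : Tor j.Mn × Fin 4 => b.1) ι)) (Ff j A') (diagK fun _ => cF * (c35 * j.Msz * α₀)) ∧
      HasMaj (BlockNorm.ofBlocks (unitTorusGeoS L j.k j.Mn j.Msz) (liftBlk (fun b : Tor j.Mn × Fin 4 => b.1) ι))
        (BlockNorm.ofBlocks (unitTorusGeoS L j.k j.Mn j.Msz) (liftBlk (blkFine L j.k j.Mn ∘ kingPrV L j.k j.m j.Mn) ι)) (Fsf j A')
        (diagK fun _ => cF * (c35 * j.Msz * α₀)) ∧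
      HasMaj (BlockNorm.ofBlocks (unitTorusGeoS L j.k j.Mn j.Msz) (liftBlk (blkFine L j.k j.Mn) ι))
        (BlockNorm.ofBlocks (unitTorusGeoS L j.k j.Mn j.Msz) (liftBlk (fun b : Tor j.Mn × Fin 4 => b.1) ι))
        (idef (pull (liftMap (kingPrV L j.k j.m j.Mn) ι)) LinearMap.id (Ff j A') (Fc j A')) (diagK fun _ => cF * (c35 * j.Msz * α₀) * thetaV L j) ∧
      HasMaj (BlockNorm.ofBlocks (unitTorusGeoS L j.k j.Mn j.Msz) (liftBlk (fun b : Tor j.Mn × Fin 4 => b.1) ι))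
        (BlockNorm.ofBlocks (unitTorusGeoS L j.k j.Mn j.Msz) (liftBlk (blkFine L j.k j.Mn ∘ kingPrV L j.k j.m j.Mn) ι))
        (idef LinearMap.id (pull (liftMap (kingPrV L j.k j.m j.Mn) ι)) (Fsf j A') (Fsc j A')) (diagK fun _ => cF * (c35 * j.Msz * α₀) * thetaV L j))
    (Ws Ws' : ∀ j : VecIndexS 3 L, ((Tor j.Mn × Fin 4) × ι → ℝ) →ₗ[ℝ] ((Tor j.Mn × Fin 4) × ι → ℝ)) {βW δW : ℝ} (hβW : 0 ≤ βW) (hδW : 0 < δW)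
    (hWs : ∀ j, HasMaj (BlockNorm.ofBlocks (unitTorusGeoS L j.k j.Mn j.Msz) (liftBlk (fun b : Tor j.Mn × Fin 4 => b.1) ι))
      (BlockNorm.ofBlocks (unitTorusGeoS L j.k j.Mn j.Msz) (liftBlk (fun b : Tor j.Mn × Fin 4 => b.1) ι)) (Ws j)
      (fun y y' => βW * Real.exp (-(δW * (unitTorusGeoS L j.k j.Mn j.Msz).dist y y'))))
    (hWs' : ∀ j, HasMaj (BlockNorm.ofBlocks (unitTorusGeoS L j.k j.Mn j.Msz) (liftBlk (fun b : Tor j.Mn × Fin 4 => b.1) ι))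
      (BlockNorm.ofBlocks (unitTorusGeoS L j.k j.Mn j.Msz) (liftBlk (fun b : Tor j.Mn × Fin 4 => b.1) ι)) (Ws' j)
      (fun y y' => βW * Real.exp (-(δW * (unitTorusGeoS L j.k j.Mn j.Msz).dist y y'))))
    (hKW : ∀ j, unitForm₀ a (liftMap (qbond L j.k j.Mn) ι) (tensorId ι (pieceG L j.Mn (L ^ j.k) j.k (rweight (d := 3) L j.k))) ∘ₗ Ws j = LinearMap.id)
    (hKW' : ∀ j, unitForm₀ a (liftMap (qbond L j.k j.Mn) ι ∘ liftMap (kingPrV L j.k j.m j.Mn) ι)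
      (tensorId ι (pieceG L j.Mn (L ^ j.m * L ^ j.k) (j.k + j.m) (rweight (d := 3) L j.k / ((L : ℝ) ^ j.m) ^ 4))) ∘ₗ Ws' j = LinearMap.id) :
    NE2PlusUnit c35 (v1GVecInstance (d := 3) 𝔄 ι L hL) (vWGCVecUnitKernel (d := 3) 𝔄 ι e L a hL Fc Fsc Ff Fsf Ws Ws') (fun _ _ => True)
      (fun j => (unitTorusGeoS L j.k j.Mn j.Msz).dist) :=
  ne2PlusUnit_vectorPiece_vWordsGC (d := 3) e a (by norm_num) hL hL2 c35 hc35 hcF Fc Fsc Ff Fsf hF Ws Ws' hβW hδW hWs hWs' hKW hKW'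

/-- **THE PARALLEL-TRANSPORT SPECIES** (`F₂ = Q∘M_{Π_Γ exp(η ad Ā) − 1}`, g4 F9; all six letters by `expF_letters`): the unit layer BY NAME with the `U ≡ 1` unit
covariances the only displayed binders. [cite: Balaban1985BackgroundPropagators, Thm 3.15 (3.187) p.432 (quantifier template), (3.57)–(3.67) pp.401–403 (shapes, mechanism)] -/
theorem ne2PlusUnit_vectorPiece_vWordsExpC (hd : 1 ≤ d) (hL : 1 ≤ L) (hL2 : 2 ≤ L) (c35 : ℝ) (hc35 : 0 < c35)
    (Ws Ws' : ∀ j : VecIndexS d L, ((Tor j.Mn × Fin (d + 1)) × ι → ℝ) →ₗ[ℝ] ((Tor j.Mn × Fin (d + 1)) × ι → ℝ)) {βW δW : ℝ} (hβW : 0 ≤ βW) (hδW : 0 < δW)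
    (hWs : ∀ j, HasMaj (BlockNorm.ofBlocks (unitTorusGeoS L j.k j.Mn j.Msz) (liftBlk (fun b : Tor j.Mn × Fin (d + 1) => b.1) ι))
      (BlockNorm.ofBlocks (unitTorusGeoS L j.k j.Mn j.Msz) (liftBlk (fun b : Tor j.Mn × Fin (d + 1) => b.1) ι)) (Ws j)
      (fun y y' => βW * Real.exp (-(δW * (unitTorusGeoS L j.k j.Mn j.Msz).dist y y'))))
    (hWs' : ∀ j, HasMaj (BlockNorm.ofBlocks (unitTorusGeoS L j.k j.Mn j.Msz) (liftBlk (fun b : Tor j.Mn × Fin (d + 1) => b.1) ι))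
      (BlockNorm.ofBlocks (unitTorusGeoS L j.k j.Mn j.Msz) (liftBlk (fun b : Tor j.Mn × Fin (d + 1) => b.1) ι)) (Ws' j)
      (fun y y' => βW * Real.exp (-(δW * (unitTorusGeoS L j.k j.Mn j.Msz).dist y y'))))
    (hKW : ∀ j, unitForm₀ a (liftMap (qbond L j.k j.Mn) ι) (tensorId ι (pieceG L j.Mn (L ^ j.k) j.k (rweight (d := d) L j.k))) ∘ₗ Ws j = LinearMap.id)
    (hKW' : ∀ j, unitForm₀ a (liftMap (qbond L j.k j.Mn) ι ∘ liftMap (kingPrV L j.k j.m j.Mn) ι)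
      (tensorId ι (pieceG L j.Mn (L ^ j.m * L ^ j.k) (j.k + j.m) (rweight (d := d) L j.k / ((L : ℝ) ^ j.m) ^ (d + 1)))) ∘ₗ Ws' j = LinearMap.id) :
    NE2PlusUnit c35 (v1GVecInstance (d := d) 𝔄 ι L hL)
      (vWGCVecUnitKernel (d := d) 𝔄 ι e L a hL (expFc ι e L) (expFsc ι e L) (expFf ι e L) (expFsf ι e L) Ws Ws') (fun _ _ => True)
      (fun j => (unitTorusGeoS L j.k j.Mn j.Msz).dist) :=
  ne2PlusUnit_vectorPiece_vWordsGC (d := d) e a hd hL hL2 c35 hc35 (expCF_nonneg_le (d := d) (basisConst_nonneg e)).1 (expFc ι e L) (expFsc ι e L)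
    (expFf ι e L) (expFsf ι e L) (fun j _ _ hα₀ hsm hreg => expF_letters (d := d) e hL j hc35 hα₀ hsm hreg) Ws Ws' hβW hδW hWs hWs' hKW hKW'

/-- **THE LINEARISED SPECIES** (`F₂ = Q∘M_{ad(ηΣ_Γ Ā)}`, g4 F7; all six letters by `linF_letters`). [cite: Balaban1985BackgroundPropagators, Thm 3.15 (3.187) p.432 (quantifier template), (3.57)–(3.67) pp.401–403 (shapes, mechanism)] -/
theorem ne2PlusUnit_vectorPiece_vWordsLinC (hd : 1 ≤ d) (hL : 1 ≤ L) (hL2 : 2 ≤ L) (c35 : ℝ) (hc35 : 0 < c35)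
    (Ws Ws' : ∀ j : VecIndexS d L, ((Tor j.Mn × Fin (d + 1)) × ι → ℝ) →ₗ[ℝ] ((Tor j.Mn × Fin (d + 1)) × ι → ℝ)) {βW δW : ℝ} (hβW : 0 ≤ βW) (hδW : 0 < δW)
    (hWs : ∀ j, HasMaj (BlockNorm.ofBlocks (unitTorusGeoS L j.k j.Mn j.Msz) (liftBlk (fun b : Tor j.Mn × Fin (d + 1) => b.1) ι))
      (BlockNorm.ofBlocks (unitTorusGeoS L j.k j.Mn j.Msz) (liftBlk (fun b : Tor j.Mn × Fin (d + 1) => b.1) ι)) (Ws j)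
      (fun y y' => βW * Real.exp (-(δW * (unitTorusGeoS L j.k j.Mn j.Msz).dist y y'))))
    (hWs' : ∀ j, HasMaj (BlockNorm.ofBlocks (unitTorusGeoS L j.k j.Mn j.Msz) (liftBlk (fun b : Tor j.Mn × Fin (d + 1) => b.1) ι))
      (BlockNorm.ofBlocks (unitTorusGeoS L j.k j.Mn j.Msz) (liftBlk (fun b : Tor j.Mn × Fin (d + 1) => b.1) ι)) (Ws' j)
      (fun y y' => βW * Real.exp (-(δW * (unitTorusGeoS L j.k j.Mn j.Msz).dist y y'))))
    (hKW : ∀ j, unitForm₀ a (liftMap (qbond L j.k j.Mn) ι) (tensorId ι (pieceG L j.Mn (L ^ j.k) j.k (rweight (d := d) L j.k))) ∘ₗ Ws j = LinearMap.id)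
    (hKW' : ∀ j, unitForm₀ a (liftMap (qbond L j.k j.Mn) ι ∘ liftMap (kingPrV L j.k j.m j.Mn) ι)
      (tensorId ι (pieceG L j.Mn (L ^ j.m * L ^ j.k) (j.k + j.m) (rweight (d := d) L j.k / ((L : ℝ) ^ j.m) ^ (d + 1)))) ∘ₗ Ws' j = LinearMap.id) :
    NE2PlusUnit c35 (v1GVecInstance (d := d) 𝔄 ι L hL)
      (vWGCVecUnitKernel (d := d) 𝔄 ι e L a hL (linFc ι e L) (linFsc ι e L) (linFf ι e L) (linFsf ι e L) Ws Ws') (fun _ _ => True)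
      (fun j => (unitTorusGeoS L j.k j.Mn j.Msz).dist) :=
  ne2PlusUnit_vectorPiece_vWordsGC (d := d) e a hd hL hL2 c35 hc35 (linCF_nonneg_le (d := d) (basisConst_nonneg e)).1 (linFc ι e L) (linFsc ι e L)
    (linFf ι e L) (linFsf ι e L) (fun j _ _ hα₀ _ hreg => linF_letters (d := d) e hL j hc35 hα₀ hreg) Ws Ws' hβW hδW hWs hWs' hKW hKW'

end Knit

end Summit.QuantumFields.YangMills.BalabanUVNodes.N15.VectorPiece

end
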